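import Summits.HodgeConjecture.HodgeConjecture.Theorems.SoloBlindPauliPrym

/-!
# SoloBlind — the abelian index-2 subgroup of the Pauli group behind the Weil-type half-Prym (finite core of PROPOSITION HP (8))

Solo programme `solo-HodgeConjecture-blind`, session s54.  Context (prose, `work/s54/prym-side.md` §B-ter):
for a hyperelliptic Pauli pair the Galois group of `C̃' → ℙ¹` is the Pauli group `G = C₄ ∘ Q₈`
(model `PauliPrym.G`, `(a,b,d) ↔ i^a j^b c^d`).  The dominance of the half-Prym map onto the
Weil-type family `(ℚ(i), (2,2), δ = 1)` reduces, via Pardini's theory of abelian covers and the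
base-point-free pencil trick, to the following FINITE facts about `G`, certified here:

* `A = ⟨c, i⟩ = {i^a c^d}` is an abelian normal subgroup of order 8 containing `c` and `s = c·i`;
* an involution outside `Q₈` lies in `A` iff it has type `i` — so `C̃'/A → ℙ¹` is branched exactly at
  the points of the two other types (four of them for the typing `(4,2,2)` with majority type `i`);
* conjugation by `j` fixes `c` and sends `s ↦ (-1)·s`: the two points of `C̃'/A` over a type-`i`
  branch point have inertia `⟨s⟩` and `⟨-s⟩`;
* `ψ₁ : A → ℤ/4` (`c ↦ 1 ≙ i`, `s ↦ 0`) is a homomorphism with `ψ₁(s) = 0`, `ψ₁(-s) = 2 ≙ -1`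
  (ramified exactly at the `⟨-s⟩` points), and `φ = 2ψ₁` kills both `s` and `-s` (the double cover
  it defines is unramified) while `φ(c) ≠ 0` (it is non-trivial);
* `-1` is a commutator, so every linear character of `G` kills it, whereas `ψ₁(-1) = 2 ≠ 0`: no linear
  character of `G` restricts to `ψ₁`.
-/

namespace Summit.HodgeConjecture.HodgeConjecture.Theorems.PauliWeil
open Summit.HodgeConjecture.HodgeConjecture.Theorems.PauliPrym

/-- Membership in `A = {i^a c^d}` (no `j`). -/
def inA (x : G) : Bool := !x.2.1

/-- `s = c · i`. -/
def s : G := gmul gc gi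

/-- Conjugation `g x g⁻¹`. -/
def conj (g x : G) : G := gmul (gmul g x) (ginv g)

/-- `A` has exactly 8 elements, contains `e`, `c`, `i`, `s`, `-1`, is closed under products and inverses,
and is abelian. -/
theorem A_subgroup :
    (allG.filter fun x => inA x).length = 8 ∧ inA e = true ∧ inA gc = true ∧ inA gi = true ∧
    inA s = true ∧ inA m1 = true ∧
    (∀ x y : G, inA x = true → inA y = true →
      inA (gmul x y) = true ∧ gmul x y = gmul y x) ∧
    (∀ x : G, inA x = true → inA (ginv x) = true) := by
  refine ⟨by decide +kernel, by decide, by decide, by decide, by decide, by decide, ?_, ?_⟩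
  · decide +kernel
  · decide +kernel

/-- `A` is normal (closed under conjugation by all of `G`), and `j ∉ A` (so `[G:A] = 2`). -/
theorem A_normal : (∀ g x : G, inA x = true → inA (conj g x) = true) ∧ inA gj = false := by
  refine ⟨by decide +kernel, by decide⟩

/-- An involution outside `Q₈` (an element of `S`) lies in `A` iff its type is `i` (`ty = 0`). -/
theorem involution_in_A : ∀ x : G, x ∈ S → (inA x = true ↔ ty x = 0) := by decide +kernel

/-- `s` is one of the type-`i` involutions, `-s = (-1)·s` is the other. -/
theorem s_type : s ∈ S ∧ ty s = 0 ∧ gmul m1 s ∈ S ∧ ty (gmul m1 s) = 0 ∧ gmul m1 s ≠ s := by decide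

/-- Conjugation by `j` fixes `c` and sends `s ↦ -s`; every conjugate of `s` is `s` or `-s`. -/
theorem conj_j : conj gj gc = gc ∧ conj gj s = gmul m1 s ∧
    ∀ g : G, conj g s = s ∨ conj g s = gmul m1 s := by
  refine ⟨by decide, by decide, by decide +kernel⟩

/-- `ψ₁ : A → ℤ/4`, `i^a c^d ↦ 3a + d` (so `c ↦ 1 ≙ i`, `i ↦ 3 ≙ i⁻¹`, `s ↦ 0`). -/
def psi1 (x : G) : Fin 4 := 3 * x.1 + (if x.2.2 then 1 else 0)

/-- `ψ₁` is a homomorphism on `A` with the stated values: `ψ₁(c) = 1`, `ψ₁(s) = 0`, `ψ₁(-s) = 2`,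
`ψ₁(-1) = 2`. -/
theorem psi1_hom :
    (∀ x y : G, inA x = true → inA y = true → psi1 (gmul x y) = psi1 x + psi1 y) ∧
    psi1 gc = 1 ∧ psi1 s = 0 ∧ psi1 (gmul m1 s) = 2 ∧ psi1 m1 = 2 := by
  refine ⟨by decide +kernel, by decide, by decide, by decide, by decide⟩

/-- `ψ₂ := ψ₁ ∘ Ad(j)` is the other character with `c ↦ i`: it agrees with `ψ₁` on `c` and differs on `s`
(`ψ₂(s) = ψ₁(-s) = 2`). -/
theorem psi2_values : psi1 (conj gj gc) = 1 ∧ psi1 (conj gj s) = 2 := by decide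

/-- `φ = 2ψ₁` (the square character) kills both inertia generators `s`, `-s` and is non-trivial
(`φ(c) = 2`). -/
theorem phi_unramified_nontrivial :
    2 * psi1 s = 0 ∧ 2 * psi1 (gmul m1 s) = 0 ∧ 2 * psi1 gc = 2 ∧ (2 : Fin 4) ≠ 0 := by decide

/-- `-1 = [i, j]` is a commutator; hence every homomorphism from `G` to an abelian group kills `-1`,
while `ψ₁(-1) = 2 ≠ 0`: no linear character of `G` restricts to `ψ₁` on `A`. -/
theorem m1_commutator : gmul (gmul (gmul gi gj) (ginv gi)) (ginv gj) = m1 ∧ psi1 m1 ≠ 0 := by decide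

end Summit.HodgeConjecture.HodgeConjecture.Theorems.PauliWeil
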